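import Literature.NumberTheory.Sieve.WelshCubicRootsLattice
import Mathlib.Data.Nat.Prime.Int
import HarnessLib

/-!
# Welsh 2018 / Hooley 1978: a generator of the ideal `(m, 2^{1/3} - ν)` of `ℤ[2^{1/3}]`

Second support file for `Literature/NumberTheory/Sieve/WelshCubicRoots.lean` (Theorem 1 of
M. C. Welsh, arXiv:1809.05211). Welsh (§3, p. 7, eq. (9)) writes the primitive ideal attached to a
root `ν` of `X³ ≡ 2 (mod m)` — the lattice `I_ν = {x + y2^{1/3} + z2^{2/3} : m ∣ x + yν + zν²}`
of his Lemma 1 — as a principal ideal `(a + b2^{1/3} + c2^{2/3})`, "using crucially that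
`ℤ[2^{1/3}]` has class number one". Here this is made explicit and elementary: starting from the
small-norm lattice point of `WelshCubicRootsLattice` (`|N| < 5m`, Minkowski), we show
* `N ≠ 0` off the origin (irrationality of `2^{1/3}` by `2`-adic descent) and `m ∣ N` on `I_ν`,
  so `N ∈ {±m, ±2m, ±3m, ±4m}`;
* descents dividing by `2^{1/3}` (norm `2`) and by `1 + 2^{1/3}` (norm `3`) inside `I_ν`
  (using `4 ∤ m`, `9 ∤ m`, `gcd(m, ν) ∣ 2`, `gcd(m, 1 + ν) ∣ 3` in the disguise `m ∣ 2X`, `m ∣ 3X`),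
ending in `exists_generator`: integers `a, b, c` with `m ∣ a + bν + cν²` and
`a³ + 2b³ + 4c³ - 6abc = m`.

## References
* [Welsh2018CubicCongruenceSpacing] M. C. Welsh, arXiv:1809.05211 (2018), Lemma 1 (p. 6), §3 (p. 7).
* [Hooley1978CubicPrimeFactor] C. Hooley, J. reine angew. Math. 303/304 (1978) 21–50.
-/

noncomputable section

namespace Literature.NumberTheory.Sieve

namespace Welsh2018

/-! ### Arithmetic of the norm form on `I_ν` and the descents -/

/-- Division with remainder as an existence statement: `ν = i + k·t` with `0 ≤ i < k`.
[folklore] -/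
theorem exists_emod_decomp (ν k : ℤ) (hk : 0 < k) :
    ∃ i t : ℤ, 0 ≤ i ∧ i < k ∧ ν = i + k * t :=
  ⟨ν % k, ν / k, Int.emod_nonneg ν hk.ne', Int.emod_lt_of_pos ν hk,
    by linarith [Int.mul_ediv_add_emod ν k]⟩

/-- `2` is not a cube modulo `4`: if `m ∣ ν³ - 2` then `4 ∤ m`. [folklore] -/
theorem not_four_dvd {m ν : ℤ} (h : m ∣ ν ^ 3 - 2) : ¬ (4 : ℤ) ∣ m := by
  intro h4
  obtain ⟨i, t, hi0, hi4, rfl⟩ := exists_emod_decomp ν 4 (by norm_num)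
  have h' : (4 : ℤ) ∣ i ^ 3 - 2 := by
    have h1 : (4 : ℤ) ∣ (i + 4 * t) ^ 3 - 2 := dvd_trans h4 h
    have e : (i + 4 * t) ^ 3 - 2 = i ^ 3 - 2 + 4 * (t * (3 * i ^ 2 + 12 * i * t + 16 * t ^ 2)) := by
      ring
    rw [e] at h1
    exact (dvd_add_left (dvd_mul_right 4 _)).mp h1
  interval_cases i <;> norm_num at h'

/-- `2` is not a cube modulo `9`: if `m ∣ ν³ - 2` then `9 ∤ m`. [folklore] -/
theorem not_nine_dvd {m ν : ℤ} (h : m ∣ ν ^ 3 - 2) : ¬ (9 : ℤ) ∣ m := by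
  intro h9
  obtain ⟨i, t, hi0, hi3, rfl⟩ := exists_emod_decomp ν 3 (by norm_num)
  have h' : (9 : ℤ) ∣ i ^ 3 - 2 := by
    have h1 : (9 : ℤ) ∣ (i + 3 * t) ^ 3 - 2 := dvd_trans h9 h
    have e : (i + 3 * t) ^ 3 - 2 = i ^ 3 - 2 + 9 * (t * (i ^ 2 + 3 * i * t + 3 * t ^ 2)) := by ring
    rw [e] at h1
    exact (dvd_add_left (dvd_mul_right 9 _)).mp h1
  interval_cases i <;> norm_num at h'

/-- Fermat modulo `3`: `3 ∣ ν³ - ν`. [folklore] -/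
theorem three_dvd_cube_sub_self (ν : ℤ) : (3 : ℤ) ∣ ν ^ 3 - ν := by
  obtain ⟨i, t, hi0, hi3, rfl⟩ := exists_emod_decomp ν 3 (by norm_num)
  have e : (i + 3 * t) ^ 3 - (i + 3 * t)
      = i ^ 3 - i + 3 * (t * (3 * i ^ 2 + 9 * i * t + 9 * t ^ 2 - 1)) := by ring
  rw [e]
  refine dvd_add ?_ (dvd_mul_right 3 _)
  interval_cases i <;> norm_num

/-- Modulo `3` the norm form is the cube of `p - q + r`: `3 ∣ N(p,q,r) - (p - q + r)³`.
[folklore] -/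
theorem three_dvd_normForm_sub_cube (p q r : ℤ) :
    (3 : ℤ) ∣ (p ^ 3 + 2 * q ^ 3 + 4 * r ^ 3 - 6 * p * q * r) - (p - q + r) ^ 3 :=
  ⟨q ^ 3 + r ^ 3 + p ^ 2 * q - p ^ 2 * r - p * q ^ 2 - q ^ 2 * r - p * r ^ 2 + q * r ^ 2, by ring⟩

/-- If `3 ∣ N(p,q,r)` then `3 ∣ p - q + r`. [folklore] -/
theorem three_dvd_of_three_dvd_normForm {p q r : ℤ}
    (h : (3 : ℤ) ∣ p ^ 3 + 2 * q ^ 3 + 4 * r ^ 3 - 6 * p * q * r) : (3 : ℤ) ∣ p - q + r := by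
  apply Int.prime_three.dvd_of_dvd_pow (n := 3)
  have := dvd_sub h (three_dvd_normForm_sub_cube p q r)
  rwa [sub_sub_cancel] at this

/-- The ideal property of `I_ν` in norm terms: for `m ∣ ν³ - 2` and `m ∣ p + qν + rν²`,
`m ∣ N(p,q,r) = p³ + 2q³ + 4r³ - 6pqr` (indeed `N ≡ N(-qν - rν², q, r) ≡ 0`).
[cite: Welsh2018CubicCongruenceSpacing, Lemma 1 (p. 6)] -/
theorem dvd_normForm {m ν p q r : ℤ} (hν : m ∣ ν ^ 3 - 2) (h : m ∣ p + q * ν + r * ν ^ 2) :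
    m ∣ p ^ 3 + 2 * q ^ 3 + 4 * r ^ 3 - 6 * p * q * r := by
  obtain ⟨e, he⟩ := hν
  obtain ⟨t, ht⟩ := h
  have hp : p = m * t - q * ν - r * ν ^ 2 := by linarith
  subst hp
  refine ⟨t * ((m * t) ^ 2 - 3 * (m * t) * (q * ν + r * ν ^ 2) + 3 * (q * ν + r * ν ^ 2) ^ 2
      - 6 * q * r) - e * (q ^ 3 + 3 * q ^ 2 * r * ν + 3 * q * r ^ 2 * ν ^ 2 + r ^ 3 * (ν ^ 3 + 2)), ?_⟩
  linear_combination (-(q ^ 3 + 3 * q ^ 2 * r * ν + 3 * q * r ^ 2 * ν ^ 2 + r ^ 3 * (ν ^ 3 + 2))) * he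

/-- The norm form of `ℤ[2^{1/3}]` vanishes only at the origin (irrationality of `2^{1/3}`, by
`2`-adic descent on `|p| + |q| + |r|`). [folklore] -/
theorem normForm_ne_zero_aux : ∀ (n : ℕ) (p q r : ℤ), p.natAbs + q.natAbs + r.natAbs ≤ n →
    (p ≠ 0 ∨ q ≠ 0 ∨ r ≠ 0) → p ^ 3 + 2 * q ^ 3 + 4 * r ^ 3 - 6 * p * q * r ≠ 0 := by
  intro n
  induction n with
  | zero =>
    intro p q r hn h
    obtain ⟨rfl, rfl, rfl⟩ : p = 0 ∧ q = 0 ∧ r = 0 := by omega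
    simp at h
  | succ n ih =>
    intro p q r hn h hN
    have two_prime : Prime (2 : ℤ) := Int.prime_two
    have hp : (2 : ℤ) ∣ p := by
      apply two_prime.dvd_of_dvd_pow (n := 3)
      exact ⟨-q ^ 3 - 2 * r ^ 3 + 3 * p * q * r, by linarith⟩
    obtain ⟨p', rfl⟩ := hp
    have hq : (2 : ℤ) ∣ q := by
      apply two_prime.dvd_of_dvd_pow (n := 3)
      exact ⟨-2 * p' ^ 3 - r ^ 3 + 3 * p' * q * r, by linarith⟩
    obtain ⟨q', rfl⟩ := hq
    have hr : (2 : ℤ) ∣ r := by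
      apply two_prime.dvd_of_dvd_pow (n := 3)
      exact ⟨-p' ^ 3 - 2 * q' ^ 3 + 3 * p' * q' * r, by linarith⟩
    obtain ⟨r', rfl⟩ := hr
    refine ih p' q' r' ?_ ?_ ?_
    · simp only [Int.natAbs_mul] at hn
      have : (2 : ℤ).natAbs = 2 := rfl
      rw [this] at hn
      omega
    · omega
    · have e : (2 * p') ^ 3 + 2 * (2 * q') ^ 3 + 4 * (2 * r') ^ 3 - 6 * (2 * p') * (2 * q') * (2 * r')
          = 8 * (p' ^ 3 + 2 * q' ^ 3 + 4 * r' ^ 3 - 6 * p' * q' * r') := by ring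
      rw [e] at hN
      linarith

/-- `N(p,q,r) ≠ 0` for `(p,q,r) ≠ 0`. [folklore] -/
theorem normForm_ne_zero {p q r : ℤ} (h : p ≠ 0 ∨ q ≠ 0 ∨ r ≠ 0) :
    p ^ 3 + 2 * q ^ 3 + 4 * r ^ 3 - 6 * p * q * r ≠ 0 :=
  normForm_ne_zero_aux _ p q r le_rfl h

/-- **Descent by `θ = 2^{1/3}` (norm `2`).** If `(p,q,r) ∈ I_ν` has norm `2M` with `m ∣ M`
(`m ∣ ν³ - 2`), then `p = 2p'`, `(p,q,r) = θ·(q,r,p')` and `(q,r,p') ∈ I_ν` has norm `M`; the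
membership uses `m ∣ 2(q + rν + p'ν²)`, `4 ∤ m` and, for even `m`, that `q` is even. [folklore] -/
theorem descent_two {m ν M p q r : ℤ} (hν : m ∣ ν ^ 3 - 2) (hM : m ∣ M)
    (hmem : m ∣ p + q * ν + r * ν ^ 2)
    (hN : p ^ 3 + 2 * q ^ 3 + 4 * r ^ 3 - 6 * p * q * r = 2 * M) :
    ∃ p' q' r' : ℤ, m ∣ p' + q' * ν + r' * ν ^ 2 ∧
      p' ^ 3 + 2 * q' ^ 3 + 4 * r' ^ 3 - 6 * p' * q' * r' = M := by
  have two_prime : Prime (2 : ℤ) := Int.prime_two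
  have hp : (2 : ℤ) ∣ p := by
    apply two_prime.dvd_of_dvd_pow (n := 3)
    exact ⟨M - q ^ 3 - 2 * r ^ 3 + 3 * p * q * r, by linarith⟩
  obtain ⟨p', rfl⟩ := hp
  have hN' : q ^ 3 + 2 * r ^ 3 + 4 * p' ^ 3 - 6 * q * r * p' = M := by
    have e : (2 * p') ^ 3 + 2 * q ^ 3 + 4 * r ^ 3 - 6 * (2 * p') * q * r
        = 2 * (q ^ 3 + 2 * r ^ 3 + 4 * p' ^ 3 - 6 * q * r * p') := by ring
    rw [e] at hN
    linarith
  refine ⟨q, r, p', ?_, hN'⟩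
  set X := q + r * ν + p' * ν ^ 2 with hX
  have h2X : m ∣ 2 * X := by
    have hνX : m ∣ ν * X := by
      have e : ν * X = (2 * p' + q * ν + r * ν ^ 2) + p' * (ν ^ 3 - 2) := by rw [hX]; ring
      rw [e]; exact dvd_add hmem (dvd_mul_of_dvd_right hν _)
    have e2 : 2 * X = ν ^ 2 * (ν * X) - X * (ν ^ 3 - 2) := by ring
    rw [e2]
    exact dvd_sub (dvd_mul_of_dvd_right hνX _) (dvd_mul_of_dvd_right hν _)
  by_cases h2m : (2 : ℤ) ∣ m
  · obtain ⟨m₁, hm₁⟩ := h2m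
    have hm₁odd : ¬ (2 : ℤ) ∣ m₁ := by
      rintro ⟨k, rfl⟩
      exact not_four_dvd hν ⟨k, by rw [hm₁]; ring⟩
    have hm₁X : m₁ ∣ X := by
      have : 2 * m₁ ∣ 2 * X := hm₁ ▸ h2X
      exact (mul_dvd_mul_iff_left two_ne_zero).mp this
    have hνeven : (2 : ℤ) ∣ ν := by
      apply two_prime.dvd_of_dvd_pow (n := 3)
      have h1 : (2 : ℤ) ∣ ν ^ 3 - 2 := dvd_trans ⟨m₁, hm₁⟩ hν
      have e : ν ^ 3 = (ν ^ 3 - 2) + 2 := by ring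
      rw [e]; exact dvd_add h1 (dvd_refl 2)
    have hMeven : (2 : ℤ) ∣ M := dvd_trans ⟨m₁, hm₁⟩ hM
    have hqeven : (2 : ℤ) ∣ q := by
      apply two_prime.dvd_of_dvd_pow (n := 3)
      obtain ⟨M', hM'⟩ := hMeven
      exact ⟨M' - r ^ 3 - 2 * p' ^ 3 + 3 * q * r * p', by linarith⟩
    have h2X' : (2 : ℤ) ∣ X := by
      obtain ⟨ν', hν'⟩ := hνeven
      obtain ⟨q', hq'⟩ := hqeven
      exact ⟨q' + r * ν' + p' * ν' * ν, by rw [hX, hq', hν']; ring⟩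
    obtain ⟨k, hk⟩ := hm₁X
    have h2k : (2 : ℤ) ∣ k := by
      rw [hk] at h2X'
      exact (two_prime.dvd_or_dvd h2X').resolve_left hm₁odd
    obtain ⟨k', rfl⟩ := h2k
    exact ⟨k', by linear_combination hk - k' * hm₁⟩
  · obtain ⟨k, hk⟩ := h2X
    have h2k : (2 : ℤ) ∣ k := by
      have h2 : (2 : ℤ) ∣ m * k := ⟨X, hk.symm⟩
      exact (two_prime.dvd_or_dvd h2).resolve_left h2m
    obtain ⟨k', rfl⟩ := h2k
    exact ⟨k', by linarith⟩

/-- **Descent by `1 + θ` (norm `3`).** If `(p,q,r) ∈ I_ν` has norm `3m` (`m ∣ ν³ - 2`), then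
`3 ∣ p - q + r =: 3k`, `(p,q,r) = (1+θ)·(k+q-r, r-k, k)` and `(k+q-r, r-k, k) ∈ I_ν` has norm `m`;
the membership uses `m ∣ 3X`, `9 ∤ m` and, when `3 ∣ m`, `ν ≡ -1 (mod 3)`. [folklore] -/
theorem descent_three {m ν p q r : ℤ} (hν : m ∣ ν ^ 3 - 2)
    (hmem : m ∣ p + q * ν + r * ν ^ 2)
    (hN : p ^ 3 + 2 * q ^ 3 + 4 * r ^ 3 - 6 * p * q * r = 3 * m) :
    ∃ p' q' r' : ℤ, m ∣ p' + q' * ν + r' * ν ^ 2 ∧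
      p' ^ 3 + 2 * q' ^ 3 + 4 * r' ^ 3 - 6 * p' * q' * r' = m := by
  have three_prime : Prime (3 : ℤ) := Int.prime_three
  have h3 : (3 : ℤ) ∣ p - q + r := three_dvd_of_three_dvd_normForm ⟨m, by linarith⟩
  obtain ⟨k, hk⟩ := h3
  have hp : p = 3 * k + q - r := by linarith
  subst hp
  have hN' : (k + q - r) ^ 3 + 2 * (r - k) ^ 3 + 4 * k ^ 3 - 6 * (k + q - r) * (r - k) * k = m := by
    have e : (3 * k + q - r) ^ 3 + 2 * q ^ 3 + 4 * r ^ 3 - 6 * (3 * k + q - r) * q * r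
        = 3 * ((k + q - r) ^ 3 + 2 * (r - k) ^ 3 + 4 * k ^ 3 - 6 * (k + q - r) * (r - k) * k) := by
      ring
    rw [e] at hN
    linarith
  refine ⟨k + q - r, r - k, k, ?_, hN'⟩
  set X := (k + q - r) + (r - k) * ν + k * ν ^ 2 with hX
  have h1X : m ∣ (1 + ν) * X := by
    have e : (1 + ν) * X = (3 * k + q - r + q * ν + r * ν ^ 2) + k * (ν ^ 3 - 2) := by
      rw [hX]; ring
    rw [e]; exact dvd_add hmem (dvd_mul_of_dvd_right hν _)
  have h3X : m ∣ 3 * X := by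
    have e : 3 * X = (1 - ν + ν ^ 2) * ((1 + ν) * X) - X * (ν ^ 3 - 2) := by ring
    rw [e]; exact dvd_sub (dvd_mul_of_dvd_right h1X _) (dvd_mul_of_dvd_right hν _)
  by_cases h3m : (3 : ℤ) ∣ m
  · obtain ⟨m₁, hm₁⟩ := h3m
    have hm₁3 : ¬ (3 : ℤ) ∣ m₁ := by
      rintro ⟨j, rfl⟩
      exact not_nine_dvd hν ⟨j, by rw [hm₁]; ring⟩
    have hm₁X : m₁ ∣ X := by
      have : 3 * m₁ ∣ 3 * X := hm₁ ▸ h3X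
      exact (mul_dvd_mul_iff_left three_ne_zero).mp this
    have hν3 : (3 : ℤ) ∣ ν + 1 := by
      have a1 : (3 : ℤ) ∣ ν ^ 3 - 2 := dvd_trans ⟨m₁, hm₁⟩ hν
      have a2 := three_dvd_cube_sub_self ν
      have a3 : (3 : ℤ) ∣ (ν ^ 3 - ν) - (ν ^ 3 - 2) - 3 := dvd_sub (dvd_sub a2 a1) (dvd_refl 3)
      have e : (ν ^ 3 - ν) - (ν ^ 3 - 2) - 3 = -(ν + 1) := by ring
      rw [e, dvd_neg] at a3; exact a3
    have h3pqr : (3 : ℤ) ∣ (k + q - r) - (r - k) + k :=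
      three_dvd_of_three_dvd_normForm (by rw [hN']; exact ⟨m₁, hm₁⟩)
    have h3X' : (3 : ℤ) ∣ X := by
      have e : X = ((k + q - r) - (r - k) + k) + (ν + 1) * ((r - k) + k * (ν - 1)) := by
        rw [hX]; ring
      rw [e]; exact dvd_add h3pqr (dvd_mul_of_dvd_left hν3 _)
    obtain ⟨j, hj⟩ := hm₁X
    have h3j : (3 : ℤ) ∣ j := by
      rw [hj] at h3X'
      exact (three_prime.dvd_or_dvd h3X').resolve_left hm₁3
    obtain ⟨j', rfl⟩ := h3j
    exact ⟨j', by linear_combination hj - j' * hm₁⟩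
  · obtain ⟨j, hj⟩ := h3X
    have h3j : (3 : ℤ) ∣ j := by
      have a : (3 : ℤ) ∣ m * j := ⟨X, hj.symm⟩
      exact (three_prime.dvd_or_dvd a).resolve_left h3m
    obtain ⟨j', rfl⟩ := h3j
    exact ⟨j', by linarith⟩

/-- **Generator of `I_ν` (Welsh's `I = (α)`, §3 p. 7; "class number one" made explicit).**
For `m ≥ 1` and `m ∣ ν³ - 2` there are integers `a, b, c` with `m ∣ a + bν + cν²` and
`a³ + 2b³ + 4c³ - 6abc = m`. (Then `α = a + b2^{1/3} + c2^{2/3}` generates the ideal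
`(m, 2^{1/3} - ν)`; see `WelshCubicRoots`.) [cite: Welsh2018CubicCongruenceSpacing, §3 eq. (9) (p. 7)] -/
theorem exists_generator (m : ℕ) (hm : 1 ≤ m) (ν : ℤ) (hν : (m : ℤ) ∣ ν ^ 3 - 2) :
    ∃ a b c : ℤ, (m : ℤ) ∣ a + b * ν + c * ν ^ 2 ∧
      a ^ 3 + 2 * b ^ 3 + 4 * c ^ 3 - 6 * a * b * c = m := by
  have hm0 : (0 : ℤ) < m := by exact_mod_cast hm
  obtain ⟨p, q, r, hne, hmem, hlt⟩ := exists_small_norm m hm ν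
  obtain ⟨j, hj⟩ := dvd_normForm hν hmem
  have hN0 := normForm_ne_zero hne
  have hj0 : j ≠ 0 := by
    rintro rfl
    rw [mul_zero] at hj
    exact hN0 hj
  have hjabs : |j| < 5 := by
    rw [hj, abs_mul, abs_of_pos hm0] at hlt
    by_contra hcon
    rw [not_lt] at hcon
    have : 5 * (m : ℤ) ≤ (m : ℤ) * |j| := by nlinarith
    linarith
  obtain ⟨hj5, hj5'⟩ := abs_lt.mp hjabs
  -- normalise the sign of the norm
  have key : ∃ p q r : ℤ, (m : ℤ) ∣ p + q * ν + r * ν ^ 2 ∧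
      ∃ j : ℤ, 1 ≤ j ∧ j ≤ 4 ∧ p ^ 3 + 2 * q ^ 3 + 4 * r ^ 3 - 6 * p * q * r = m * j := by
    rcases lt_or_gt_of_ne hj0 with hneg | hpos
    · refine ⟨-p, -q, -r, ?_, -j, by omega, by omega, by linear_combination (-1 : ℤ) * hj⟩
      have e : -p + -q * ν + -r * ν ^ 2 = -(p + q * ν + r * ν ^ 2) := by ring
      rw [e, dvd_neg]; exact hmem
    · exact ⟨p, q, r, hmem, j, by omega, by omega, hj⟩
  obtain ⟨p, q, r, hmem, j, hj1, hj4, hN⟩ := key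
  have hcases : j = 1 ∨ j = 2 ∨ j = 3 ∨ j = 4 := by omega
  rcases hcases with rfl | rfl | rfl | rfl
  · exact ⟨p, q, r, hmem, by linarith⟩
  · exact descent_two hν (dvd_refl _) hmem (by linarith)
  · exact descent_three hν hmem (by linarith)
  · obtain ⟨p₁, q₁, r₁, hmem₁, hN₁⟩ :=
      descent_two (M := 2 * (m : ℤ)) hν (dvd_mul_left _ 2) hmem (by linarith)
    exact descent_two hν (dvd_refl _) hmem₁ (by linarith)

end Welsh2018

end Literature.NumberTheory.Sieve
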